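import Summits.BirchSwinnertonDyer.BirchSwinnertonDyer.Theorems.UniversalToricDescentThinCombContRigidity
import HarnessLib

/-!
# Line `ratwall_thin_comb` on the RATIONAL WALL `RationalSplitIMCInclusionAtThree` (stmt-BirchSwinnertonDyer-24207): cross-period
# rigidity UP TO POWERS OF `p` of the handed BDP frame against a frame known only UP TO A CONSTANT `C ∈ ℂ_pˣ` and only at characters
# admitting a continuation (`--supports stmt-BirchSwinnertonDyer-24207`; cell `pub/bsd-wall`, lead `cruxlead-24207` g0; any prime `p`;
# sorry-free; no named fact; imports no `Theses` module)

WHY. The sibling file `UniversalToricDescentThinCombContRigidity.lean` (lead `cruxlead-20395` g4) proves, for the handed BDP frame `L`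
(`IsBDPLFunction`, exact display) and a series `L′` carrying the EXACT BDP values at other periods `(Ω′_K, Ω′_p)` wherever `L(f/K, φ, s)`
admits a continuation: `L = 0 ∨ (L′) = (L)`. On the RATIONAL road (crux 24207, bounded `3`-power slack allowed) the two-variable toric
function need only exist UP TO A CONSTANT (`Literature…IsToricTwoVarLFunctionUpTo C`, `C ≠ 0` recording denominators, e.g. Hida's
congruence number), and then its central-ray restriction `L′ = spec (p^k) L₂` carries `C` TIMES the BDP values. The conclusion weakens
accordingly to the ♯-shape of cn100's LEMMA R∞: `L = 0 ∨ ∃ a b w, IsUnit w ∧ p^a·L′ = p^b·(w·L)` — `L` and `L′` generate the same ideal of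
`R₀⟦T⟧ ⊗ ℚ`, which is all a `p`-power-slack inclusion consumes (§3 bookkeeping).

* §1 **`eq_zero_or_rel_of_isBDPLFunction_of_contUpTo`** (any prime; `K` imaginary quadratic, `κ` anticyclotomic, `γ` a topological
  generator; periods and `C` non-zero): the junk dichotomy + R∞ steps 1–2 of the sibling proof run with the constant `A := C`
  (`CongruentShaFreeCutBDPUpToPowerMapIdentity.powerMap_identity_of_values`, `CongruentShaFreeCutPowerMapSeriesRigidity.exists_C_pow_mul_eq_of_powerMap_identity`);
  the `a = b` step of the sibling is NOT available (and false in general: `‖C‖ ≠ 1`).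
* §2 **`eq_zero_or_rel_spec_of_toricUpTo_values`**: the toric instance in a v2 frame of the `ℤ_p²`-tower (`γ₁γ⁻¹, γ₂(γ^{p^k})⁻¹ ∈ ker κ`),
  stated on the VALUES form of the ♯-toric predicate (`∀ ψ a b …, HasValueAt₂ L₂ … (C · display · Ω_p^{2(a+b)})`, i.e. the body of
  `IsToricTwoVarLFunctionUpTo C`), so that this file depends on no new definition: `L = 0 ∨ ∃ a b w, IsUnit w ∧ p^a·spec (p^k) L₂ = p^b·(w·L)`.
* §3 **`pow_mul_mem_of_rel`** (bookkeeping): from `p^a·L′ = p^b·(w·L)`, `w` a unit, a membership `p^j·L′ ∈ I` gives `p^{j+b}·L ∈ I`.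

References: [Castella2018] Thm. 3.1 (arXiv:1704.06608 p. 9); [CastellaWan2023] Thm. 2.11, Cor. 2.12 (arXiv:1607.02019 §2.4);
[Hida1988AIF] §5 Thm. 5.1b (congruence denominators); [Washington1997] §7.1–7.2. Nothing about BSD is proved here; no statement of a
Summit is closed by this file.
-/

noncomputable section

open scoped Classical Topology

set_option linter.dupNamespace false
set_option autoImplicit false

namespace Summit.BirchSwinnertonDyer.BirchSwinnertonDyer.Theorems.UniversalToricDescentRatwallThinComb.ContRigidityUpTo

open Filter PowerSeries NumberField IsDedekindDomain Field
  Literature.NumberTheory.EllipticCurves Literature.NumberTheory.EllipticCurves.ModularForms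
  Literature.NumberTheory.GaloisRepresentations
  Summit.BirchSwinnertonDyer.Rank1Residual.X11b
  Summit.BirchSwinnertonDyer.Rank1Residual.X11b.Halves
  Summit.BirchSwinnertonDyer.BirchSwinnertonDyer.Theorems.CongruentShaFreeCutCharacterSupply
  Summit.BirchSwinnertonDyer.BirchSwinnertonDyer.Theorems.CongruentShaFreeCutBDPUpToPowerMapIdentity
  Summit.BirchSwinnertonDyer.BirchSwinnertonDyer.Theorems.CongruentShaFreeCutPowerMapSeriesRigidity
  Summit.BirchSwinnertonDyer.BirchSwinnertonDyer.Theorems.UniversalToricDescentTwinSplit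
  Summit.BirchSwinnertonDyer.BirchSwinnertonDyer.Theorems.UniversalToricDescentThinComb
open Summit.BirchSwinnertonDyer.BirchSwinnertonDyer.Theorems.UniversalToricDescentThinComb.ContRigidity
  (bdpInterpolationValue_eq_zero_of_not_exists)

/-! ## §1 Rigidity up to powers of `p` against a continuation-conditional ♯-frame, or the handed frame is `0` -/

section AnyPrime

variable {p : ℕ} [hp : Fact p.Prime] {K : Type} [Field K] [NumberField K] {N : ℕ}
  {ι : PadicAlgCl p ≃+* ℂ} {𝔭 : HeightOneSpectrum (𝓞 K)} {κ : ZpExtension K p}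
  {γ : Field.absoluteGaloisGroup K} {f : CuspForm (CongruenceSubgroup.Gamma0 N) 2}
  {ΩK ΩK' : ℂ} {Ωp Ωp' C : ℂ_[p]} {L L' : UnrSeries p}

/-- **The junk dichotomy + R∞, ♯-form.** `K` imaginary quadratic, `κ` anticyclotomic with topological generator `γ`, non-zero periods,
`C ≠ 0`. Let `L` satisfy `IsBDPLFunction ι 𝔭 κ γ f Ω_K Ω_p L` and let `L′ ∈ R₀⟦T⟧` take `C` TIMES the BDP value at `(Ω′_K, Ω′_p)` at every
`(φ, n, r)` of the range for which `L(f/K, φ, s)` HAS an entire continuation. Then `L = 0`, or `p^a·L′ = p^b·(w·L)` for some `a b : ℕ` and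
a unit `w` of `R₀⟦T⟧`. Proof: along the supply `φ_k = φ₀^{p^k}` (points `x_k → 0`, `x_k ≠ 0`), if the continuation fails at infinitely many
`k` then `L(x_k) = 0` there (junk value), so `L = 0` (identity principle); otherwise from some index on `L′(x_k) = C·β^{m p^k}·L(x_k)`
(`X11b.frameValue_rescale`), whence the power-type functional equation with constant `C^{p−1}` (`powerMap_identity_of_values`, `A := C`) and
`p^a L′ = p^b (w L)` (`exists_C_pow_mul_eq_of_powerMap_identity`). [cite: Castella2018, Thm. 3.1 (arXiv:1704.06608 p. 9)] [cite: Washington1997, §7.1–7.2] -/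
theorem eq_zero_or_rel_of_isBDPLFunction_of_contUpTo (hK : IsImaginaryQuadratic K)
    (hκ : κ.IsAnticyclotomic) (hγ : κ.IsTopGenerator γ) (hΩK : ΩK ≠ 0) (hΩK' : ΩK' ≠ 0) (hΩp : Ωp ≠ 0)
    (hΩp' : Ωp' ≠ 0) (hC : C ≠ 0) (hL : IsBDPLFunction ι 𝔭 κ γ f ΩK Ωp L)
    (hL' : ∀ (φ : HeckeCharacter K) (n : ℕ), 0 < n → (∀ v : HeightOneSpectrum (𝓞 K), φ.IsUnramifiedAt v) →
      φ.HasInfinityType (fun _ ↦ (n : ℤ)) (fun _ ↦ -(n : ℤ)) →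
      ∀ r : FramedGaloisRep K (PadicAlgCl p) 1, IsPAdicAvatarOf ι φ r → FactorsThroughZp κ r →
      (∃ Lc : ℂ → ℂ, Differentiable ℂ Lc ∧
        ∀ s : ℂ, 3 / 2 < s.re → Lc s = rankinSelbergEulerProductHecke f φ s) →
      L'.HasValueAt (avatarValueAt r γ - 1)
        (C * ((((ι.symm (bdpInterpolationValue p f 𝔭 φ n ΩK')) : PadicAlgCl p) : ℂ_[p]) * Ωp' ^ (4 * n)))) :
    L = 0 ∨ ∃ (a b : ℕ) (w : UnrSeries p), IsUnit w ∧
      PowerSeries.C (((p : ℕ) : unrIntegers p) ^ a) * L' =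
        PowerSeries.C (((p : ℕ) : unrIntegers p) ^ b) * (w * L) := by
  by_cases h0 : L = 0
  · exact Or.inl h0
  right
  -- the supply of interpolation characters
  obtain ⟨m, x₀, φ, φ', r, r', hm, hx1, hx, hunr, hinf, hr, hrκ, hval, -, -, -, -, -⟩ :=
    characterSupplyAt (p := p) K ι κ γ hK hκ hγ
  set x : ℕ → ℂ_[p] := fun k ↦ x₀ ^ p ^ k - 1 with hxdef
  have hT0 : Tendsto x atTop (𝓝 0) := by
    have := hx.sub_const 1
    simpa [hxdef] using this
  have hx0 : ∀ k, x k ≠ 0 := fun k ↦ sub_ne_zero.mpr (hx1 k)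
  have hnpos : ∀ k, 0 < m * p ^ k := fun k ↦ Nat.mul_pos hm (pow_pos hp.out.pos _)
  -- the values of the handed frame at `x k`
  set V : ℕ → ℂ_[p] := fun k ↦
    ((ι.symm (bdpInterpolationValue p f 𝔭 (φ k) (m * p ^ k) ΩK) : PadicAlgCl p) : ℂ_[p]) *
      Ωp ^ (4 * (m * p ^ k)) with hVdef
  set β : ℂ_[p] := ((ι.symm ((ΩK / ΩK') ^ 4) : PadicAlgCl p) : ℂ_[p]) * (Ωp' / Ωp) ^ 4 with hβdef
  have hβ0 : β ≠ 0 := by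
    refine mul_ne_zero ?_ (pow_ne_zero _ (div_ne_zero hΩp' hΩp))
    rw [PadicComplex.coe_eq]
    exact (map_ne_zero_iff _ (algebraMap (PadicAlgCl p) ℂ_[p]).injective).mpr
      ((map_ne_zero_iff _ ι.symm.injective).mpr (pow_ne_zero _ (div_ne_zero hΩK hΩK')))
  have hLval : ∀ k, L.HasValueAt (x k) (V k) := fun k ↦ by
    have h := hL.hasValueAt (hnpos k) (hunr k) (hinf k) (hr k) (hrκ k)
    rwa [hval] at h
  -- eventually `‖x k‖ < 1`
  have hev : ∀ᶠ k in atTop, ‖x k‖ < 1 := by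
    have h := hT0.norm
    rw [norm_zero] at h
    exact h.eventually (gt_mem_nhds zero_lt_one)
  -- JUNK DICHOTOMY: the continuation holds eventually along the supply (otherwise `L = 0`)
  have hcont : ∀ᶠ k in atTop, ∃ Lc : ℂ → ℂ, Differentiable ℂ Lc ∧
      ∀ s : ℂ, 3 / 2 < s.re → Lc s = rankinSelbergEulerProductHecke f (φ k) s := by
    by_contra hcon
    rw [Filter.not_eventually] at hcon
    obtain ⟨σ, hσ, hσP⟩ := Filter.extraction_of_frequently_atTop hcon
    apply h0
    refine unrSeries_eq_of_hasValueAt (x := fun k ↦ x (σ k)) (v := fun _ ↦ 0)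
      (hT0.comp hσ.tendsto_atTop) (Frequently.of_forall fun k ↦ hx0 _) (fun k ↦ ?_)
      (fun k ↦ hasValueAt_zero_series _)
    have hV0 : V (σ k) = 0 := by
      simp only [hVdef]
      rw [bdpInterpolationValue_eq_zero_of_not_exists p 𝔭 (m * p ^ σ k) ΩK (hσP k), map_zero]
      simp
    have h := hLval (σ k)
    rwa [hV0] at h
  obtain ⟨K₁, hK₁⟩ := eventually_atTop.mp hcont
  -- the values of the conditional ♯-frame at `x k`, `k ≥ K₁`
  have hL'val : ∀ k, K₁ ≤ k → L'.HasValueAt (x k) (C * β ^ (m * p ^ k) * V k) := fun k hk ↦ by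
    have h := hL' (φ k) (m * p ^ k) (hnpos k) (hunr k) (hinf k) (r k) (hr k) (hrκ k) (hK₁ k hk)
    rw [frameValue_rescale ι f 𝔭 (φ k) (m * p ^ k) hΩK hΩK' Ωp' hΩp, hval] at h
    have e : C * (V k * β ^ (m * p ^ k)) = C * β ^ (m * p ^ k) * V k := by ring
    rw [e] at h
    exact h
  -- `V k ≠ 0` frequently (identity principle: otherwise `L = 0`)
  have hfreq : ∃ᶠ k in atTop, V k ≠ 0 := by
    by_contra hcon
    have hV : ∀ᶠ k in atTop, V k = 0 := by simpa [Filter.not_frequently] using hcon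
    obtain ⟨K₂, hK₂⟩ := eventually_atTop.mp hV
    apply h0
    refine unrSeries_eq_of_hasValueAt (x := fun k ↦ x (k + K₂)) (v := fun _ ↦ 0)
      (hT0.comp (tendsto_add_atTop_nat K₂))
      (Frequently.of_forall fun k ↦ hx0 _) (fun k ↦ ?_)
      (fun k ↦ hasValueAt_zero_series _)
    have h := hLval (k + K₂)
    rwa [hK₂ (k + K₂) (Nat.le_add_left K₂ k)] at h
  -- good indices: `‖x k‖ < 1`, `V k ≠ 0`, `K₁ ≤ k`
  have hgood : ∃ᶠ k in atTop, ‖x k‖ < 1 ∧ V k ≠ 0 ∧ K₁ ≤ k :=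
    (hfreq.and_eventually (hev.and (eventually_ge_atTop K₁))).mono fun k h ↦ ⟨h.2.1, h.1, h.2.2⟩
  -- `L' ≠ 0`
  have h0' : L' ≠ 0 := by
    obtain ⟨k, hxk, hVk, hk⟩ := hgood.exists
    intro hz
    have h1 := hL'val k hk
    rw [hz] at h1
    have h2 : C * β ^ (m * p ^ k) * V k = 0 := h1.unique (hasValueAt_zero_series _)
    exact (mul_ne_zero (mul_ne_zero hC (pow_ne_zero _ hβ0)) hVk) h2
  -- the shifted supply `k ↦ k + K₃` with `‖x‖ < 1` and the continuation available
  obtain ⟨K₀, hK₀⟩ : ∃ K₀, ∀ k ≥ K₀, ‖x k‖ < 1 := eventually_atTop.mp hev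
  set K₃ : ℕ := max K₀ K₁ with hK₃
  have hxK : ∀ k, ‖x (k + K₃)‖ < 1 := fun k ↦
    hK₀ _ (le_trans (le_max_left K₀ K₁) (Nat.le_add_left K₃ k))
  have hK₁K : ∀ k, K₁ ≤ k + K₃ := fun k ↦ le_trans (le_max_right K₀ K₁) (Nat.le_add_left K₃ k)
  -- R∞ step 1: the power-type functional equation with the constant `C`, from values
  have hid := powerMap_identity_of_values (p := p) (L := L) (L' := L') (x := fun k ↦ x (k + K₃))
    (V := fun k ↦ V (k + K₃)) (n := fun k ↦ m * p ^ (k + K₃)) (A := C) (β := β)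
    hxK (fun k ↦ hx0 _) (hT0.comp (tendsto_add_atTop_nat K₃)) (fun k ↦ ?_) (fun k ↦ ?_)
    (fun k ↦ hLval _) (fun k ↦ hL'val (k + K₃) (hK₁K k))
  rotate_left
  · show x₀ ^ p ^ (k + 1 + K₃) - 1 = (1 + (x₀ ^ p ^ (k + K₃) - 1)) ^ p - 1
    have e : k + 1 + K₃ = k + K₃ + 1 := by omega
    rw [e, add_sub_cancel, ← pow_mul, ← pow_succ]
  · show m * p ^ (k + 1 + K₃) = p * (m * p ^ (k + K₃))
    have e : k + 1 + K₃ = k + K₃ + 1 := by omega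
    rw [e, pow_succ]
    ring
  -- R∞ step 2: `p^a L' = p^b (w L)`
  exact exists_C_pow_mul_eq_of_powerMap_identity h0 h0' hid

end AnyPrime

/-! ## §2 The toric ♯-instance: `spec (p^k) L₂` against the handed BDP frame, NO continuation hypothesis -/

section Toric

variable {p : ℕ} [Fact p.Prime]

/-- **K3 of line `ratwall_thin_comb` in ♯-currency.** `K` imaginary quadratic, `p = 𝔭𝔭′` split, `κ` anticyclotomic with topological
generator `γ`, `(κ₁, κ₂; γ₁, γ₂)` a generator pair with the v2 frame relations `γ₁γ⁻¹ ∈ ker κ`, `γ₂(γ^{p^k})⁻¹ ∈ ker κ`. If `L` is a BDP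
frame of `f` at `(Ω_K, Ω_p)` (the crux's handed frame) and `L₂ ∈ R₀⟦T₁⟧⟦T₂⟧` carries `C` TIMES the toric two-variable values at
`(Ω′_K, Ω′_p)` on the critical cone (the VALUES form of `IsToricTwoVarLFunctionUpTo C`, `C ≠ 0`), then `L = 0` or
`p^a·spec (p^k) L₂ = p^b·(w·L)` for some `a b : ℕ` and a unit `w`: at a character `φ` of the BDP range ADMITTING a continuation, the
♯-toric values give `C` times the BDP value of `spec (p^k) L₂` at `φ̂(γ) − 1` (`φ(𝔭′) = φ(𝔭)⁻¹` by `KatzLineFrame`, central ray, line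
geometry, `LineValue`), which is all §1 asks for. [cite: CastellaWan2023, §2.4 Cor. 2.12 (arXiv:1607.02019)] [cite: Castella2018, Thm. 3.1] -/
theorem eq_zero_or_rel_spec_of_toricUpTo_values
    (K : Type) [Field K] [NumberField K] (N : ℕ) (f : CuspForm (CongruenceSubgroup.Gamma0 N) 2)
    (hK : IsImaginaryQuadratic K) (κ : ZpExtension K p) (hκ : κ.IsAnticyclotomic) (γ : Field.absoluteGaloisGroup K)
    (hγ : κ.IsTopGenerator γ) (𝔭 : HeightOneSpectrum (𝓞 K)) (h𝔭 : ((p : ℕ) : 𝓞 K) ∈ 𝔭.asIdeal)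
    (𝔭' : HeightOneSpectrum (𝓞 K)) (h𝔭' : ((p : ℕ) : 𝓞 K) ∈ 𝔭'.asIdeal) (hne : 𝔭' ≠ 𝔭)
    (ι : PadicAlgCl p ≃+* ℂ) (κ₁ κ₂ : ZpExtension K p) (γ₁ γ₂ : Field.absoluteGaloisGroup K) (k : ℕ)
    (hpair : ZpExtension.IsTopGeneratorPair κ₁ κ₂ γ₁ γ₂)
    (hγ₁ : γ₁ * γ⁻¹ ∈ κ.kerSubgroup) (hγ₂ : γ₂ * (γ ^ (p ^ k))⁻¹ ∈ κ.kerSubgroup)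
    {ΩK : ℂ} {Ωp : ℂ_[p]} {L : UnrSeries p} (hΩK : ΩK ≠ 0) (hΩp : Ωp ≠ 0)
    (hL : IsBDPLFunction ι 𝔭 κ γ f ΩK Ωp L)
    {ΩK' : ℂ} {Ωp' C : ℂ_[p]} {L₂ : PowerSeries (UnrSeries p)} (hΩK' : ΩK' ≠ 0) (hΩp' : Ωp' ≠ 0) (hC : C ≠ 0)
    (hL₂ : ∀ (ψ : HeckeCharacter K) (a b : ℕ), 1 ≤ a → 1 ≤ b →
      ψ.HasInfinityType (fun _ ↦ (a : ℤ)) (fun _ ↦ -(b : ℤ)) →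
      (∀ w : HeightOneSpectrum (𝓞 K), ψ.IsUnramifiedAt w) →
      ∀ r : FramedGaloisRep K (PadicAlgCl p) 1, IsPAdicAvatarOf ι ψ r → FactorsThroughPair κ₁ κ₂ r →
      ∀ Lc : ℂ → ℂ, Differentiable ℂ Lc →
        (∀ s : ℂ, (a : ℝ) + 2 < s.re → Lc s = rankinSelbergEulerProductHecke f ψ s) →
        UnrSeries.HasValueAt₂ L₂ (avatarValueAt r γ₁ - 1) (avatarValueAt r γ₂ - 1)
          (C * ((((ι.symm (toricInterpolationValue p f 𝔭 𝔭' ψ a b ΩK' (Lc 1))) : PadicAlgCl p) : ℂ_[p]) *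
            Ωp' ^ (2 * (a + b))))) :
    L = 0 ∨ ∃ (a b : ℕ) (w : UnrSeries p), IsUnit w ∧
      PowerSeries.C (((p : ℕ) : unrIntegers p) ^ a) * TwoVarSubst.spec (p ^ k) L₂ =
        PowerSeries.C (((p : ℕ) : unrIntegers p) ^ b) * (w * L) := by
  refine eq_zero_or_rel_of_isBDPLFunction_of_contUpTo hK hκ hγ hΩK hΩK' hΩp hΩp' hC hL ?_
  intro φ n hn hunr hinf r hr hκr hcont
  obtain ⟨Lc, hLd, hLe⟩ := hcont
  -- the avatar factors through the pair
  have hpr : FactorsThroughPair κ₁ κ₂ r :=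
    PrintCf2.GeneratorPairSupply.factorsThroughPair_of_factorsThroughZp_of_isImaginaryQuadratic hK hpair κ hκr
  -- `φ(𝔭′) = φ(𝔭)⁻¹`
  haveI : IsCMField K := hK.isCMField
  have hφc := KatzLineFrame.galConj_complexConj_eq_inv_of_factorsThroughZp hK ι hκ hr hκr hunr
  have hsmul : IsCMField.complexConj K • 𝔭 = 𝔭' :=
    KatzLineFrame.complexConj_smul_eq_of_ne hK (Fact.out : p.Prime) h𝔭 h𝔭' hne
  have hψ : heckeValueExtZero φ 𝔭' = (heckeValueExtZero φ 𝔭)⁻¹ := by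
    rw [heckeValueExtZero_of_isUnramifiedAt (hunr _), heckeValueExtZero_of_isUnramifiedAt (hunr _), ← hsmul]
    exact KatzLineFrame.valueAtUniformizer_smul_of_galConj_eq_inv hφc hunr 𝔭
  -- the ♯ two-variable value on the central ray
  have hLe' : ∀ s : ℂ, (n : ℝ) + 2 < s.re → Lc s = rankinSelbergEulerProductHecke f φ s :=
    fun s hs ↦ hLe s (by have : (0 : ℝ) ≤ n := Nat.cast_nonneg n; linarith)
  have h2 := hL₂ φ n n hn hn hinf hunr r hr hpr Lc hLd hLe'
  rw [← rankinSelbergValueHecke_eq hLd hLe 1, toricInterpolationValue_diag_eq_bdpInterpolationValue p f hψ n ΩK'] at h2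
  have e : C * ((((ι.symm (bdpInterpolationValue p f 𝔭 φ n ΩK')) : PadicAlgCl p) : ℂ_[p]) * Ωp' ^ (2 * (n + n))) =
      C * ((((ι.symm (bdpInterpolationValue p f 𝔭 φ n ΩK')) : PadicAlgCl p) : ℂ_[p]) * Ωp' ^ (4 * n)) := by
    ring_nf
  rw [e] at h2
  -- read on the line
  rw [LineGeometry.interpolationPoint_mem_line hκr hγ₁ hγ₂, LineGeometry.avatarValueAt_frame_fst hκr hγ₁] at h2
  have hx : ‖avatarValueAt r γ - 1‖ < 1 := ZpExtension.norm_avatarValueAt_sub_one_lt hκr hγ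
  exact (LineValue.hasValueAt₂_line_iff_hasValueAt_spec (p ^ k) L₂ hx _).mp h2

end Toric

/-! ## §3 Bookkeeping: transporting a `p`-power-slack membership along `p^a·L′ = p^b·(w·L)` -/

section Bookkeeping

variable {p : ℕ} [Fact p.Prime]

/-- `((p : ℕ) : R₀⟦T⟧) ^ n = C ((p : R₀) ^ n)`. [folklore] -/
theorem natCast_pow_eq_C_pow (n : ℕ) :
    (((p : ℕ) : UnrSeries p) ^ n) = PowerSeries.C (((p : ℕ) : unrIntegers p) ^ n) := by
  rw [map_pow, map_natCast]

/-- **Slack transport.** If `p^a·L′ = p^b·(w·L)` with `w` a unit of `R₀⟦T⟧` and `p^j·L′ ∈ I` for an ideal `I` of `R₀⟦T⟧`, then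
`p^{j+b}·L ∈ I`. (The consumer: `L′ = spec (p^k) L₂` with its `p^j`-inclusion from the rational descent, `L` the handed frame.)
[folklore] -/
theorem pow_mul_mem_of_rel {a b j : ℕ} {L L' w : UnrSeries p} (hw : IsUnit w)
    (hrel : PowerSeries.C (((p : ℕ) : unrIntegers p) ^ a) * L' = PowerSeries.C (((p : ℕ) : unrIntegers p) ^ b) * (w * L))
    {I : Ideal (UnrSeries p)} (h : ((p : ℕ) : UnrSeries p) ^ j * L' ∈ I) :
    ((p : ℕ) : UnrSeries p) ^ (j + b) * L ∈ I := by
  obtain ⟨u, rfl⟩ := hw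
  have h1 : ((p : ℕ) : UnrSeries p) ^ (j + b) * L =
      ↑u⁻¹ * (((p : ℕ) : UnrSeries p) ^ j * (PowerSeries.C (((p : ℕ) : unrIntegers p) ^ b) * (↑u * L))) := by
    rw [pow_add, natCast_pow_eq_C_pow b]
    calc ((p : ℕ) : UnrSeries p) ^ j * PowerSeries.C (((p : ℕ) : unrIntegers p) ^ b) * L
        = (↑u⁻¹ * ↑u) * (((p : ℕ) : UnrSeries p) ^ j * PowerSeries.C (((p : ℕ) : unrIntegers p) ^ b) * L) := by
          rw [Units.inv_mul, one_mul]
      _ = ↑u⁻¹ * (((p : ℕ) : UnrSeries p) ^ j * (PowerSeries.C (((p : ℕ) : unrIntegers p) ^ b) * (↑u * L))) := by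
          ring
  have key : ((p : ℕ) : UnrSeries p) ^ (j + b) * L =
      (↑u⁻¹ * PowerSeries.C (((p : ℕ) : unrIntegers p) ^ a)) * (((p : ℕ) : UnrSeries p) ^ j * L') := by
    rw [h1, ← hrel]
    ring
  rw [key]
  exact I.mul_mem_left _ h

end Bookkeeping

end Summit.BirchSwinnertonDyer.BirchSwinnertonDyer.Theorems.UniversalToricDescentRatwallThinComb.ContRigidityUpTo

end
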